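import Mathlib.MeasureTheory.Measure.Haar.NormedSpace
import Mathlib.Analysis.Complex.Isometry
import Mathlib.Analysis.SpecialFunctions.Complex.Circle
import Literature.Probability.Percolation.FKLoopNestingTestFunctions
import Literature.Probability.LatticeModels.SixVertexGFF
import HarnessLib

/-!
# Similarity invariance of the Dirichlet energy of a neutral density (DKLM 2026, Def. 6 / §5)

Duminil-Copin–Kozlowski–Lammers–Manolescu, arXiv:2603.06268 (2026), state Cor. 10 for the
random-cluster model on the diagonal lattice `δ𝕃(π/2)`, whose loops run along `δℤ²` and couple
(Baxter–Kelland–Wu, their (3.2)) to the six-vertex height function on the faces of `δℤ²`; the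
tree's rendering `Literature.Probability.Percolation.dklm2026_corollary10` puts the model on `δℤ²`
with loops on its medial lattice, which differs from the paper's picture by a planar similarity
`S(z) = a z + b` (`a = √2 e^{iπ/4}` up to the mesh, plus a half-mesh offset; module docstring of
`FKLoopNestingGaussianLimit`). Transporting a test density `f` on the loop side to the six-vertex
side therefore means taking the pushforward of `f dz` under `S`, whose density is
`ρ(w) = |a|⁻² f((w - b)/a)`, and the claim "the right-hand side of Cor. 10 is unchanged" is the
similarity invariance of the Dirichlet energy of NEUTRAL densities:
`∬ G_{ℝ²} ρ ⊗ ρ = ∬ G_{ℝ²} f ⊗ f` because `G_{ℝ²}(Sz, Sz') = G_{ℝ²}(z, z') - (1/2π) log|a|` and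
`∫ f = 0` kills the constant. This file proves it, in the form consumed by the six-vertex side
(`Literature.Probability.LatticeModels.SixVertex.dirichletEnergy ρ`, a Lebesgue double integral,
versus `Literature.Probability.Percolation.dirichletEnergy (f dz)`):

* `integral_comp_mul_left_complex`, `integral_comp_similarity`: `∫ F(a z + b) dz = |a|⁻² ∫ F`
  (rotations are measure preserving — Mathlib's `rotation` isometry — and the real dilation by
  `|a|` scales planar Lebesgue measure by `|a|²`); no integrability needed;
* `integral_mul_pushforwardDensity`: `∫ g ρ = ∫ (g ∘ S) f`; `integral_pushforwardDensity(_eq_zero)`,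
  `continuous_pushforwardDensity`, `hasCompactSupport_pushforwardDensity`: `ρ` is again a
  continuous compactly supported zero-mean density when `f` is (the hypotheses of the tree's
  Thm. 2.8, `SixVertex.DKLM2026_sixVertex_heightFunction_GFF`, mode (2));
* `sixVertex_dirichletEnergy_of_pushforward`, `sixVertex_dirichletEnergy_pushforwardDensity`:
  `SixVertex.dirichletEnergy ρ = dirichletEnergy (f dz)` for `f` bounded, measurable, vanishing
  off a ball, of zero mean.

With `FKLoopNestingGaussianGlue.tendsto_integral_loopNestingWeight_of_sixVertexGFF` this leaves
exactly the BKW identity (3.2) (for `ρ` and `φ = f dz`) as the hypothesis under which the tree's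
Thm. 2.8 yields Cor. 10 for bounded continuous compactly supported densities.

## References

* H. Duminil-Copin, K. K. Kozlowski, P. Lammers, I. Manolescu, arXiv:2603.06268 (2026): Def. 6(ii),
  §3.2 (3.2), §5 p. 37 (`φ_{δ𝕃(θ),q}` versus `δℤ²`).
* H. Duminil-Copin, K. K. Kozlowski, D. Krachun, I. Manolescu, M. Oulamara, arXiv:2012.11672v2,
  §1.4 (`𝕃(π/2)` versus `ℤ²`).
-/

noncomputable section

open MeasureTheory Set Filter Metric Complex
open scoped Real Topology

namespace Literature.Probability.Percolation

open LatticeModels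

/-! ### Change of variables under a planar similarity `z ↦ a z + b` -/

/-- Lebesgue change of variables under multiplication by `a ≠ 0` on `ℂ = ℝ²`:
`∫ F(a z) dz = |a|⁻² ∫ F(w) dw` (rotation is measure preserving, the real dilation by `|a|` scales
Lebesgue measure by `|a|²`); no integrability needed. [folklore] -/
theorem integral_comp_mul_left_complex (F : ℂ → ℝ) {a : ℂ} (ha : a ≠ 0) :
    ∫ z, F (a * z) = (‖a‖ ^ 2)⁻¹ * ∫ w, F w := by
  set r : ℝ := ‖a‖ with hr
  have hr0 : 0 < r := norm_pos_iff.2 ha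
  set u : Circle := Circle.exp (arg a) with hu
  have hau : a = (r : ℂ) * (u : ℂ) := by
    rw [hu, Circle.coe_exp, hr]
    exact (norm_mul_exp_arg_mul_I a).symm
  have h1 : (fun z ↦ F (a * z)) = fun z ↦ (fun w ↦ F (r • w)) (rotation u z) := by
    funext z
    simp only [rotation_apply, Complex.real_smul, hau, mul_assoc]
  rw [h1, MeasureTheory.integral_comp (rotation u) (fun w ↦ F (r • w)), Measure.integral_comp_smul]
  simp only [Complex.finrank_real_complex, smul_eq_mul]
  rw [abs_of_nonneg (by positivity)]

/-- Lebesgue change of variables under the similarity `S(z) = a z + b`, `a ≠ 0`: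
`∫ F(a z + b) dz = |a|⁻² ∫ F(w) dw`. [folklore] -/
theorem integral_comp_similarity (F : ℂ → ℝ) {a : ℂ} (ha : a ≠ 0) (b : ℂ) :
    ∫ z, F (a * z + b) = (‖a‖ ^ 2)⁻¹ * ∫ w, F w := by
  have h := integral_comp_mul_left_complex (fun w ↦ F (w + b)) ha
  rw [h, integral_add_right_eq_self F b]

/-- **The pushforward density.** For a density `f` and the similarity `S(z) = a z + b` (`a ≠ 0`),
the image of the signed measure `f dz` under `S` has density `ρ(w) = |a|⁻² f((w - b)/a)`:
`∫ g ρ dw = ∫ (g ∘ S) f dz` for every `g`. [folklore] -/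
theorem integral_mul_pushforwardDensity (g f : ℂ → ℝ) {a : ℂ} (ha : a ≠ 0) (b : ℂ) :
    ∫ w, g w * ((‖a‖ ^ 2)⁻¹ * f ((w - b) / a)) = ∫ z, g (a * z + b) * f z := by
  have h := integral_comp_similarity (fun w ↦ g w * ((‖a‖ ^ 2)⁻¹ * f ((w - b) / a))) ha b
  simp only [add_sub_cancel_right, mul_div_cancel_left₀ _ ha] at h
  have hn : (‖a‖ ^ 2)⁻¹ ≠ 0 := inv_ne_zero (pow_ne_zero 2 (norm_ne_zero_iff.2 ha))
  have h2 : ∫ z, g (a * z + b) * ((‖a‖ ^ 2)⁻¹ * f z) = (‖a‖ ^ 2)⁻¹ * ∫ z, g (a * z + b) * f z := by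
    rw [← integral_const_mul]
    refine integral_congr_ae (ae_of_all _ fun z ↦ ?_)
    ring
  rw [h2] at h
  exact (mul_right_injective₀ hn h).symm

/-- The pushforward density has the same total mass: `∫ ρ = ∫ f`. [folklore] -/
theorem integral_pushforwardDensity (f : ℂ → ℝ) {a : ℂ} (ha : a ≠ 0) (b : ℂ) :
    ∫ w, (‖a‖ ^ 2)⁻¹ * f ((w - b) / a) = ∫ z, f z := by
  have := integral_mul_pushforwardDensity (fun _ ↦ (1 : ℝ)) f ha b
  simpa only [one_mul] using this


/-! ### Similarity invariance of the Dirichlet energy of a neutral density -/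

section Volume

variable {f : ℂ → ℝ} {C R : ℝ}

/-- `y ↦ f(y) log‖x - y‖` is integrable for `f` bounded, measurable, vanishing off a ball.
[folklore] -/
theorem integrable_mul_log_norm_sub (hf : Measurable f) (hC : ∀ z, |f z| ≤ C)
    (hR : ∀ z, R < ‖z‖ → f z = 0) (x : ℂ) :
    Integrable (fun y : ℂ ↦ f y * Real.log ‖x - y‖) := by
  have heq : (fun y ↦ f y * Real.log ‖x - y‖) =
      (closedBall (0 : ℂ) R).indicator fun y ↦ f y * Real.log ‖x - y‖ := by
    funext y
    by_cases hy : y ∈ closedBall (0 : ℂ) R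
    · rw [indicator_of_mem hy]
    · rw [indicator_of_notMem hy, hR y (by simpa [mem_closedBall, dist_zero_right] using hy),
        zero_mul]
  rw [heq, integrable_indicator_iff measurableSet_closedBall]
  have hmeas : Measurable fun y : ℂ ↦ Real.log ‖x - y‖ :=
    Real.measurable_log.comp (continuous_const.sub continuous_id).norm.measurable
  refine Integrable.mono' ((integrableOn_log_norm_sub_right x R).norm.const_mul C)
    ((hf.mul hmeas).aestronglyMeasurable) (Eventually.of_forall fun y ↦ ?_)
  rw [norm_mul, Real.norm_eq_abs]
  exact mul_le_mul_of_nonneg_right (hC y) (norm_nonneg _)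

/-- **Similarity invariance of the Dirichlet energy of a neutral density** (abstract pushforward
form): if `ρ` is the density of the image of `f dz` under `S(z) = a z + b`, `a ≠ 0`
(`∫ g ρ = ∫ (g ∘ S) f` for all `g`), and `∫ f = 0`, then the six-vertex file's energy of `ρ` is
the energy of `f dz`: `∬ G ρ ⊗ ρ = ∬ G_{ℝ²} d(f dz) d(f dz)` — because
`G(Sz, Sz') = G(z, z') - (1/2π) log|a|` off the diagonal and the constant integrates to
`-(1/2π) log|a| (∫ f)² = 0`. This is the invariance used to pass between DKLM's loops on `δℤ²`
and the tree's loops on the medial lattice (module docstring of `FKLoopNestingGaussianLimit`).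
[cite: DuminilCopinKozlowskiLammersManolescu2026, Def. 6(ii) and §5 p. 37] -/
theorem sixVertex_dirichletEnergy_of_pushforward {ρ : ℂ → ℝ} (hf : Measurable f)
    (hC : ∀ z, |f z| ≤ C) (hR : ∀ z, R < ‖z‖ → f z = 0) (h0 : ∫ z, f z = 0) {a : ℂ} (ha : a ≠ 0)
    (b : ℂ) (hρ : ∀ g : ℂ → ℝ, ∫ w, g w * ρ w = ∫ z, g (a * z + b) * f z) :
    SixVertex.dirichletEnergy ρ = dirichletEnergy ((volume : Measure ℂ).withDensityᵥ f) := by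
  have hfi : Integrable f := integrable_of_abs_le_of_eq_zero hf hC hR
  have hlog : ∀ x : ℂ, Integrable (fun y : ℂ ↦ Real.log ‖x - y‖ * f y) := fun x ↦ by
    simpa only [mul_comm] using integrable_mul_log_norm_sub hf hC hR x
  rw [dirichletEnergy_withDensityᵥ hf hC hR, SixVertex.dirichletEnergy]
  -- Step 1: pull `ρ z` out of the inner integral
  have h1 : ∀ z, ∫ w, SixVertex.greenPlane z w * ρ z * ρ w =
      (∫ w, SixVertex.greenPlane z w * ρ w) * ρ z := by
    intro z
    rw [← integral_mul_const]
    refine integral_congr_ae (ae_of_all _ fun w ↦ ?_)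
    ring
  simp_rw [h1]
  -- Step 2: change variables in the outer integral
  have h2 := hρ (fun z ↦ ∫ w, SixVertex.greenPlane z w * ρ w)
  beta_reduce at h2
  rw [h2]
  -- Step 3: change variables in the inner integral
  have h3 : ∀ z, ∫ w, SixVertex.greenPlane (a * z + b) w * ρ w =
      ∫ z', SixVertex.greenPlane (a * z + b) (a * z' + b) * f z' := fun z ↦ hρ _
  simp_rw [h3]
  -- Step 4: `G(Sz, Sz') = -(1/2π)(log|a| + log|z - z'|)` off the diagonal; the `log|a|` term dies
  have h4 : ∀ z, ∫ z', SixVertex.greenPlane (a * z + b) (a * z' + b) * f z' =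
      -(1 / (2 * π)) * ∫ z', Real.log ‖z - z'‖ * f z' := by
    intro z
    have hae : ∀ᵐ z' ∂(volume : Measure ℂ), z' ≠ z := by
      have : ({z}ᶜ : Set ℂ) ∈ ae (volume : Measure ℂ) := compl_mem_ae_iff.2 (measure_singleton z)
      filter_upwards [this] with z' hz'
      exact hz'
    have heq : ∫ z', SixVertex.greenPlane (a * z + b) (a * z' + b) * f z' =
        ∫ z', (-(1 / (2 * π)) * Real.log ‖a‖ * f z' + -(1 / (2 * π)) * (Real.log ‖z - z'‖ * f z')) := by
      refine integral_congr_ae ?_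
      filter_upwards [hae] with z' hz'
      have hzz : ‖z' - z‖ ≠ 0 := norm_ne_zero_iff.2 (sub_ne_zero.2 hz')
      rw [SixVertex.greenPlane, show a * z' + b - (a * z + b) = a * (z' - z) by ring, norm_mul,
        Real.log_mul (norm_ne_zero_iff.2 ha) hzz, norm_sub_rev z' z]
      ring
    rw [heq, integral_add (hfi.const_mul _) ((hlog z).const_mul _), integral_const_mul,
      integral_const_mul, h0, mul_zero, zero_add]
  simp_rw [h4]
  -- Step 5: match the two iterated integrals
  rw [← integral_const_mul]
  refine integral_congr_ae (ae_of_all _ fun z ↦ ?_)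
  dsimp only
  have h5 : ∫ y, Real.log ‖z - y‖ * f z * f y = f z * ∫ y, Real.log ‖z - y‖ * f y := by
    rw [← integral_const_mul]
    refine integral_congr_ae (ae_of_all _ fun y ↦ ?_)
    ring
  rw [h5]
  ring

/-- **The Dirichlet energy of the pushforward density** `ρ(w) = |a|⁻² f((w - b)/a)` of a neutral
bounded compactly supported density `f` under `z ↦ a z + b` equals that of `f dz`.
[cite: DuminilCopinKozlowskiLammersManolescu2026, Def. 6(ii) and §5 p. 37] -/
theorem sixVertex_dirichletEnergy_pushforwardDensity (hf : Measurable f) (hC : ∀ z, |f z| ≤ C)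
    (hR : ∀ z, R < ‖z‖ → f z = 0) (h0 : ∫ z, f z = 0) {a : ℂ} (ha : a ≠ 0) (b : ℂ) :
    SixVertex.dirichletEnergy (fun w ↦ (‖a‖ ^ 2)⁻¹ * f ((w - b) / a)) =
      dirichletEnergy ((volume : Measure ℂ).withDensityᵥ f) :=
  sixVertex_dirichletEnergy_of_pushforward hf hC hR h0 ha b
    (fun g ↦ integral_mul_pushforwardDensity g f ha b)

/-- The pushforward density of a zero-mean density has zero mean. [folklore] -/
theorem integral_pushforwardDensity_eq_zero (h0 : ∫ z, f z = 0) {a : ℂ} (ha : a ≠ 0) (b : ℂ) :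
    ∫ w, (‖a‖ ^ 2)⁻¹ * f ((w - b) / a) = 0 := by
  rw [integral_pushforwardDensity f ha b, h0]

/-- The pushforward density of a continuous density is continuous. [folklore] -/
theorem continuous_pushforwardDensity (hfc : Continuous f) (a b : ℂ) :
    Continuous fun w ↦ (‖a‖ ^ 2)⁻¹ * f ((w - b) / a) := by
  fun_prop

/-- The pushforward density of a compactly supported density is compactly supported (`a ≠ 0`).
[folklore] -/
theorem hasCompactSupport_pushforwardDensity (hfs : HasCompactSupport f) {a : ℂ} (ha : a ≠ 0)
    (b : ℂ) : HasCompactSupport fun w ↦ (‖a‖ ^ 2)⁻¹ * f ((w - b) / a) := by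
  set φ : ℂ ≃ₜ ℂ := (Homeomorph.addRight (-b)).trans (Homeomorph.mulLeft₀ a⁻¹ (inv_ne_zero ha))
    with hφ
  have h : HasCompactSupport ((fun _ : ℂ ↦ (‖a‖ ^ 2)⁻¹) * (f ∘ φ)) :=
    (hfs.comp_homeomorph φ).mul_left
  have e : (fun w ↦ (‖a‖ ^ 2)⁻¹ * f ((w - b) / a)) = (fun _ : ℂ ↦ (‖a‖ ^ 2)⁻¹) * (f ∘ φ) := by
    funext w
    simp only [Pi.mul_apply, Function.comp_apply, hφ, Homeomorph.trans_apply,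
      Homeomorph.coe_addRight, Homeomorph.coe_mulLeft₀]
    congr 1
    rw [div_eq_inv_mul, sub_eq_add_neg]
  rw [e]
  exact h

end Volume
end Literature.Probability.Percolation

end
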